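import Literature.MathematicalPhysics.QuantumFieldTheory.Balaban1983to89.B1Eq324BenfattoKernelSect5ClassUpperStepFrame
import Literature.MathematicalPhysics.QuantumFieldTheory.Balaban1983to89.B1Eq324BenfattoKernelSect5PavementChainUpper
import Literature.MathematicalPhysics.QuantumFieldTheory.Balaban1983to89.B1Eq324BenfattoKernelSect5CollectErrors
import HarnessLib

/-!
# `Balaban1983to89.B1Eq324BenfattoKernelSect5UpperAssembly` — [BenfattoEtAl1978] Basic Lemma (4.6) p. 152, §5 p. 159 «(5.12) can be bounded above by the
# r.h.s. of (5.35) with b replaced by γ⁻¹b … In this case also we get (4.6)», FOR THE CONDITIONED GAUSSIAN FIELD OF A CLASS KERNEL: the KNIT — seat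
# n08-d's class upper chain `upperPavementChainCond` down to the first EMPTY support, fed at every step by the class upper step (per-box UPPER bounds AND
# the upper identification from the class rows), telescoped by the class collection of errors (4.6)-side; outcome: (4.6) for `P̄^K_{C,z̄}`, ONE CHOICE OF
# EVERYTHING, every error CLOSED and displayed in a single real ledger inequality (the mirror of `…KernelSect5LowerAssembly`)

statement-level skeleton of published theorems with citation tags; proofs where landed; nothing here is a claim about the
Yang–Mills mass gap

WHY THIS MODULE (cell `pub-ymgap`, seat `dag-n08-c` gen 32; node N08 [Balaban1985UV3]; the [BenfattoEtAl1978] source chain behind the (α)-row `h324`;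
the (4.6) side of my assembly layer `…PerBoxAtPavementUpper → …StepBoundUpper → …ClassUpperStep → …ClassUpperStepFrame → …UpperAssembly` over seat
n08-d's class upper chain S8b `…KernelSect5PavementChainUpper` (p619737 + v1.1 p623433)).  The class twin of my concrete `…Sect5UpperAssembly` with the
same difference of presentation as on the (4.7) side: the ledger inequality is displayed with the chain's own cardinalities and index sets (`|J_i|`, `|B_i|`,
`|Γ̄₁(B_i)|`, the cross-row sums over `(Λ − σ_{i+1}) − ((C_i+τ_i) ∪ Γ₁(B_i))`, `|□′∪Γ₂|`) and the class price `2P′_i` in n08-d's letters — the currency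
conversion (`≤ |I|·errTerm`, seat n08-b's `…KernelSect5LedgerPrice` / `…LedgerDischargeUpper`) is a separate, measure-free module — and with ONE
improvement asked for by seat n08-b (I.35763, the stopping index): the chain is run for a GENERAL number of steps `n` down to the first empty support
`J_n = ∅` (hypothesis), not for `d + 1` separated steps — so that no step with an empty pavement is priced (the `d + 1`-step form follows from
`…Sect5PavementChain.chain_eq_empty_of_sep` in one line).

THE KNIT.  (1) n08-d `…KernelSect5PavementChainUpper.upperPavementChainCond(_le_exp_of_eq_empty)` (p619737 / v1.2 p625353): `n` displaced class upper steps in drifting frames under the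
conditioned class field `P̄^K_{C_i,z̄_i}` (conditioning set translated along, ANY conditioning values), per-box UPPER bounds `u_i(□)` displayed per step,
its part kernels indexed by `shrink L m w − (C_i+τ_i)` and served from the standard part kernels by n08-d's parts adapter
`partKernel_row_sdiff_of_disjoint` (v1.1 p623433; `C_i + τ_i` misses the parts), closed at the stopping index `J_n = ∅` by n08-d's driver
`upperPavementChainCond_le_exp_of_eq_empty` (v1.2 p625353: the terminal conditioned integral is the small-field volume of a probability measure, `≤ 1`); (2) my `…KernelSect5ClassUpperStepFrame.exists_upper_step_of_classRows_frame`
at every step `i < n` (frame `σ_{i+1}`, displacement `τ_i`, datum `(J_i, I_i, A_i, b_i)`, conditioning set `C_i`): THERE IS `u_i` with exactly S8b's `hbox`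
AND the identification `Σ_□u_i(□) ≤ cS_{G_{i+1}}(H^{A_i(·−τ_i)}_{J_i+τ_i}) − cS_{G_{i+1}}(H^{A_i(·−τ_i)}_{Γ̄₁(B_i)}) + idErr_i`, `idErr_i` CLOSED — chosen by
`Classical.choice` over `i`; (3) my `…KernelSect5CollectErrors.le_exp_cumulantSum_add_of_chain` (§3, v1.1 p623431): the drifting-frame telescope + `J_n = ∅`
turn (1)+(2)+ledger into (4.6).  `B_i := (J_i + τ_i).image boxIndex` is SUBSTITUTED for n08-d's free `Bs` (their `hB` is `subset_rfl`).

WHAT IS PROVED (theorems only; no definition, no named fact, no `sorry`; axioms standard).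
* ★★★ `integral_condFieldK_le_exp_cumulantSum_add_of_ledger` — (4.6) FOR `P̄^K_{C_0,z̄_0}`, ONE CHOICE OF EVERYTHING, AT THE STOPPING INDEX: for a class
  member `(Λ, A, K)` (`Λ ≠ ∅`) with its class rows and guard, chain data `(J_i ⊆ I_i, A_i, b_i, C_i, z̄_i, τ_i, σ_i)` obeying the recursions (hypotheses
  discharged by `rfl` for recursively defined sequences; `γb_{i+1} = b_i`), `C_0 ⊆ Λ`, pavements and translated conditioning sets inside the frames,
  `C_i + τ_i` missing the parts and `|·−·|₂`-far (`≥ R`) from the boxes, definitional (standard) part kernels, the per-step constant ties, `J_n = ∅`, and ONE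
  displayed real inequality `Σ_{i<n}(c′_i + idErr_i) ≤ E_tot` (all terms CLOSED):
  `∫Π_Δχ̂^{I_0}_{γb_0} e^{H^{A_0}_{J_0}} dP̄^K_{C_0,z̄_0} ≤ exp(cumulantSum μ_K H^{A_0}_{J_0} t + E_tot)`.
  (Print's `n = d + 1` separated steps: feed `hJn := …Sect5PavementChain.chain_eq_empty_of_sep hL hrecJ hsep` — a one-line instance, not restated here
  to keep the file under the 400-line cap.)

HONEST SCOPE / NOT HERE.  The currency conversion of the ledger to `|I|·errTerm(α, ε₀, C)`, the choice of the printed parameters (`L ≈ b²`,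
`w = 2v ≈ 2Mb^{3/2}`, `γ`, `R = b³`) and the Basic-Lemma knit with the (4.7) side (`…KernelSect5LowerAssembly`) are measure-free sequels; the class, its rows
and the smallness conditions are OURS ([Balaban1985BackgroundPropagators] Sect. E at temperature zero), not print's `P̂₀`; one self-located piece of an
UNCOMMISSIONED port (plan g81 (II), START-LIST v11 §n08) — nothing chained into any node count; NO generalised Basic Lemma is asserted beyond this
displayed-ledger form; nothing of [Balaban1985UV3] is asserted; count-neutral for N08; nothing about d = 4, the continuum, OS axioms, a mass gap or the Clay
problem.
-/

noncomputable section

open MeasureTheory ProbabilityTheory Finset Matrix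
open scoped BigOperators Nat NNReal

namespace Literature.MathematicalPhysics.QuantumFieldTheory.Balaban1983to89.B1Eq324BenfattoKernelSect5UpperAssembly

open _root_.MeasureTheory _root_.ProbabilityTheory
open Literature.Probability.LatticeModels (setPartitions)
open Literature.MathematicalPhysics.QuantumFieldTheory
open Literature.MathematicalPhysics.QuantumFieldTheory.Balaban1983to89.B1Eq324BenfattoLemma
open Literature.MathematicalPhysics.QuantumFieldTheory.Balaban1983to89.B1Eq324BenfattoSect5Boxes
open Literature.MathematicalPhysics.QuantumFieldTheory.Balaban1983to89.B1Eq324BenfattoSect5Eq511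
open Literature.MathematicalPhysics.QuantumFieldTheory.Balaban1983to89.B1Eq324BenfattoSect5Eq524
open Literature.MathematicalPhysics.QuantumFieldTheory.Balaban1983to89.B1Eq324BenfattoSect5Eq534
open Literature.MathematicalPhysics.QuantumFieldTheory.Balaban1983to89.B1Eq324BenfattoSect5Eq515
open Literature.MathematicalPhysics.QuantumFieldTheory.Balaban1983to89.B1Eq324BenfattoSect5Iteration (restrictCoef shiftCoef)
open Literature.MathematicalPhysics.QuantumFieldTheory.Balaban1983to89.B1Eq324BenfattoKernelOfPrecision (isPosSemidefKernel_kernel)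
open Literature.MathematicalPhysics.QuantumFieldTheory.Balaban1983to89.B1Eq324BenfattoClassAppendixC (posDef_of_coercive)
open Literature.MathematicalPhysics.QuantumFieldTheory.Balaban1983to89.B1Eq324BenfattoKernelSect5Iteration (mem_image_sub_iff)
open Literature.MathematicalPhysics.QuantumFieldTheory.Balaban1983to89.B1Eq324BenfattoKernelSect5PavementChainUpper
  (upperPavementChainCond_le_exp_of_eq_empty partKernel_row_sdiff_of_disjoint)
open Literature.MathematicalPhysics.QuantumFieldTheory.Balaban1983to89.B1Eq324BenfattoKernelSect5ClassUpperStepFrame (exists_upper_step_of_classRows_frame)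
open Literature.MathematicalPhysics.QuantumFieldTheory.Balaban1983to89.B1Eq324BenfattoKernelSect5CollectErrors (le_exp_cumulantSum_add_of_chain)
open Literature.MathematicalPhysics.QuantumFieldTheory.Balaban1983to89.B1Eq324BenfattoSect5PavementChain (chain_invariants chain_eq_empty_of_sep)
open Literature.MathematicalPhysics.QuantumFieldTheory.Balaban1983to89.B1Eq324GaussianMomentLeaf (momentConst)

variable {d : ℕ}

section Assembly

variable {Λ : Finset (B1Eq324BenfattoLemma.Site d)} {A : Matrix Λ Λ ℝ}
  {K : B1Eq324BenfattoLemma.Site d → B1Eq324BenfattoLemma.Site d → ℝ}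
  (hK : ∀ x y, K x y = if h : x ∈ Λ ∧ y ∈ Λ then (A⁻¹ : Matrix Λ Λ ℝ) ⟨x, h.1⟩ ⟨y, h.2⟩ else 0)
  {s D : ℕ} {κ : ℝ} {L w v : ℕ} {γ Ac : ℝ}

include hK

/-- ★★★ **(4.6) FOR THE CONDITIONED GAUSSIAN FIELD OF A CLASS KERNEL, ONE CHOICE OF EVERYTHING, AT THE STOPPING INDEX — «In this case also we get (4.6)».**
For a class member `(Λ, A, K)` (`Λ ≠ ∅`; `A` symmetric `γ_A`-coercive; Euclidean Combes–Thomas row `J_c < γ_A` at rate `θ > 0`; growth rows `V`, `M`;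
half-rate rows `V₂`, `M₂`; quarter-rate growth row `V₄`; guard `J_c/(cosh θw − 1) < γ_A`), print's pavement parameters (`2(2w+v) < L`, `0 < w`, `v ≤ w`),
contraction `0 ≤ γ ≤ 1`, a number of steps `n`, chain data `J_i ⊆ I_i`, `A_i`, `b_i ≥ 1` with `γb_i ≥ 1`, conditioning data `(C_i, z̄_i)` (`C_0 ⊆ Λ`, ANY values
`z̄_i`), displacements `τ_i`, kernel offsets `σ_0 = 0`, `σ_{i+1} = σ_i − τ_i` obeying the recursions `J_{i+1} = (J_i + τ_i) ∩ Γ̄₁(B_i)`, `I_{i+1} = I_i + τ_i`,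
`A_{i+1} = (A_i(·−τ_i))|_{Γ̄₁(B_i)}`, `C_{i+1} = C_i + τ_i`, `z̄_{i+1} = z̄_i∘(·−τ_i)`, `γb_{i+1} = b_i` with `B_i = (J_i + τ_i).image boxIndex`, `A_0` supported in
`J_0` and bounded by `A_c`, (5.19)'s `L^d e^{−b_i²/4} ≤ 1/6` at every step, the step-`i` pavement and `C_i + τ_i` inside the frame `Λ − σ_{i+1}`, `C_i + τ_i`
missing the parts and `|·−·|₂`-far (`≥ R`) from the boxes, the definitional (standard) part kernels, letters `Kᵤ_i ≤ K₀_i`, `ε₃₁_i`, `δ` tied to the class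
constants per step, THE STOPPING CONDITION `J_n = ∅`, and the LEDGER `Σ_{i<n}(c′_i + idErr_i) ≤ E_tot` — `c′_i = err₅₁₁(i) + err₅₃₄(i) + 2P′_i` the class
upper chain's structural cost and `idErr_i = Σ_{□∈B_i}Err_i(□) + CUMB_i` the closed identification error, both DISPLAYED —:
`∫Π_Δχ̂^{I_0}_{γb_0} e^{H^{A_0}_{J_0}} dP̄^K_{C_0,z̄_0} ≤ exp(cumulantSum μ_K H^{A_0}_{J_0} t + E_tot)`.  Proof: `upperPavementChainCond_le_exp_of_eq_empty` with `u_i` chosen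
from `exists_upper_step_of_classRows_frame` and the parts adapter, then `le_exp_cumulantSum_add_of_chain`.
[cite: BenfattoEtAl1978, Basic Lemma (4.6) p.152; §5 (5.36) p.159 «In this case also we get (4.6)»; Balaban1985BackgroundPropagators, (1.16)–(1.18) p.180, Sect. E p.428 (class form; ours)] -/
theorem integral_condFieldK_le_exp_cumulantSum_add_of_ledger (hΛ : Λ.Nonempty)
    (hAs : ∀ e e', A e e' = A e' e) {γA : ℝ} (hγA0 : 0 < γA)
    (hγA : ∀ x : Λ → ℝ, γA * ∑ e, x e ^ 2 ≤ ∑ e, ∑ e', A e e' * x e * x e')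
    {θ Jc V M V₂ M₂ V₄ : ℝ} (hθ : 0 < θ)
    (hJc : ∀ e : Λ, ∑ e' : Λ, |A e e'| * (Real.cosh (θ * Real.sqrt (∑ j, ((((e : B1Eq324BenfattoLemma.Site d) j : ℝ) - ((e' : B1Eq324BenfattoLemma.Site d) j : ℝ))) ^ 2)) - 1) ≤ Jc)
    (hJcγ : Jc < γA)
    (hV : ∀ e : Λ, ∑ e' : Λ, Real.exp (-(θ * Real.sqrt (∑ j, ((((e : B1Eq324BenfattoLemma.Site d) j : ℝ) - ((e' : B1Eq324BenfattoLemma.Site d) j : ℝ))) ^ 2))) *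
      (1 + Real.sqrt (∑ j, ((((e : B1Eq324BenfattoLemma.Site d) j : ℝ) - ((e' : B1Eq324BenfattoLemma.Site d) j : ℝ))) ^ 2)) ≤ V)
    (hM : ∀ e : Λ, ∑ e' : Λ, |A e e'| * (1 + Real.sqrt (∑ j, ((((e : B1Eq324BenfattoLemma.Site d) j : ℝ) - ((e' : B1Eq324BenfattoLemma.Site d) j : ℝ))) ^ 2)) ≤ M)
    (hV₂ : ∀ e : Λ, ∑ e' : Λ, Real.exp (-(θ / 2 * Real.sqrt (∑ j, ((((e : B1Eq324BenfattoLemma.Site d) j : ℝ) - ((e' : B1Eq324BenfattoLemma.Site d) j : ℝ))) ^ 2))) ≤ V₂)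
    (hM₂ : ∀ e : Λ, ∑ e' : Λ, |A e e'| * Real.exp (θ / 2 * Real.sqrt (∑ j, ((((e : B1Eq324BenfattoLemma.Site d) j : ℝ) - ((e' : B1Eq324BenfattoLemma.Site d) j : ℝ))) ^ 2)) ≤ M₂)
    (hV₄ : ∀ e : Λ, ∑ e' : Λ, Real.exp (-(θ / 4 * Real.sqrt (∑ j, ((((e : B1Eq324BenfattoLemma.Site d) j : ℝ) - ((e' : B1Eq324BenfattoLemma.Site d) j : ℝ))) ^ 2))) *
      (1 + Real.sqrt (∑ j, ((((e : B1Eq324BenfattoLemma.Site d) j : ℝ) - ((e' : B1Eq324BenfattoLemma.Site d) j : ℝ))) ^ 2)) ≤ V₄)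
    (hguard : Jc / (Real.cosh (θ * w) - 1) < γA)
    (hκ : 0 < κ) (hL2 : 2 * (2 * w + v) < L) (hw : 0 < w) (hv : v ≤ w) (hγ0 : 0 ≤ γ) (hγ1 : γ ≤ 1) (hAc0 : 0 ≤ Ac)
    {n : ℕ}
    {Js Is Cs : ℕ → Finset (B1Eq324BenfattoLemma.Site d)} {as : ℕ → Coef d} {zs : ℕ → B1Eq324BenfattoLemma.Site d → ℝ} {bs : ℕ → ℝ} {τ σ : ℕ → B1Eq324BenfattoLemma.Site d}
    (hsupp : CoefSupportedIn (as 0) (Js 0))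
    (hA : ∀ (p : ℕ) (Δ : Fin p → B1Eq324BenfattoLemma.Site d) (nn : Fin p → ℕ), |as 0 p Δ nn| ≤ Ac) (hJI : Js 0 ⊆ Is 0) (hC0 : Cs 0 ⊆ Λ)
    (hrecJ : ∀ k < n, Js (k + 1) = (Js k).image (fun x => x + τ k) ∩ corridorsBar L w v (((Js k).image fun x => x + τ k).image (boxIndex L)))
    (hrecI : ∀ k < n, Is (k + 1) = (Is k).image fun x => x + τ k)
    (hreca : ∀ k < n, as (k + 1) = restrictCoef (shiftCoef (as k) (-τ k)) (corridorsBar L w v (((Js k).image fun x => x + τ k).image (boxIndex L))))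
    (hrecC : ∀ k < n, Cs (k + 1) = (Cs k).image fun x => x + τ k)
    (hrecz : ∀ k < n, zs (k + 1) = fun y => zs k (y - τ k))
    (hrecb : ∀ k < n, γ * bs (k + 1) = bs k) (hb : ∀ k < n, 1 ≤ bs k) (hγb : ∀ k < n, 1 ≤ γ * bs k)
    (hsmall : ∀ k < n, ((L : ℝ) ^ d) * Real.exp (-(bs k ^ 2 / 4)) ≤ 1 / 6)
    (hσ0 : σ 0 = 0) (hrecσ : ∀ k < n, σ (k + 1) = σ k - τ k)
    (hCΛ : ∀ k < n, (Cs k).image (fun x => x + τ k) ⊆ Λ.image fun y => y - σ (k + 1))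
    (hΓΛ : ∀ k < n, corridors L w (((Js k).image fun x => x + τ k).image (boxIndex L)) ⊆ Λ.image fun y => y - σ (k + 1))
    (hBΛ : ∀ k, k < n → ∀ m ∈ (((Js k).image fun x => x + τ k).image (boxIndex L)), box L m ⊆ Λ.image fun y => y - σ (k + 1))
    {Kbs : ℕ → B1Eq324BenfattoLemma.Site d → B1Eq324BenfattoLemma.Site d → B1Eq324BenfattoLemma.Site d → ℝ}
    (hKbs : ∀ k (hk : k < n) m (hm : m ∈ (((Js k).image fun x => x + τ k).image (boxIndex L))) x y, Kbs k m x y = if h : x ∈ shrink L m w ∧ y ∈ shrink L m w then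
      (((A.submatrix (fun j : ↥(Λ.image fun y => y - σ (k + 1)) => (⟨(j : B1Eq324BenfattoLemma.Site d) + σ (k + 1), (mem_image_sub_iff (σ (k + 1))).mp j.2⟩ : Λ))
          (fun j : ↥(Λ.image fun y => y - σ (k + 1)) => (⟨(j : B1Eq324BenfattoLemma.Site d) + σ (k + 1), (mem_image_sub_iff (σ (k + 1))).mp j.2⟩ : Λ))).submatrix
          (fun j : ↥(shrink L m w) => (⟨j, hBΛ k hk m hm (shrink_subset_box L m w j.2)⟩ : ↥(Λ.image fun y => y - σ (k + 1))))
          (fun j : ↥(shrink L m w) => (⟨j, hBΛ k hk m hm (shrink_subset_box L m w j.2)⟩ : ↥(Λ.image fun y => y - σ (k + 1)))))⁻¹ :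
          Matrix ↥(shrink L m w) ↥(shrink L m w) ℝ) ⟨x, h.1⟩ ⟨y, h.2⟩ else 0)
    (hCsh : ∀ k, k < n → ∀ m ∈ (((Js k).image fun x => x + τ k).image (boxIndex L)), Disjoint (shrink L m w) ((Cs k).image fun x => x + τ k)) {R : ℝ}
    (hCfar : ∀ k, k < n → ∀ m ∈ (((Js k).image fun x => x + τ k).image (boxIndex L)), ∀ x ∈ box L m, ∀ c ∈ (Cs k).image (fun x => x + τ k),
      R ≤ Real.sqrt (∑ j, (((x j : ℝ) - (c j : ℝ))) ^ 2))
    {Ku K₀ ε₃₁ : ℕ → ℝ} (hKuI : ∀ k < n, (1 + M₂ * V₄ / (γA - Jc) * (γ + 1)) * bs k ≤ Ku k) (hKuK : ∀ k < n, Ku k ≤ K₀ k)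
    (hK₀ : ∀ k < n, 1 / (γA - Jc) ≤ K₀ k) (hK₀1 : ∀ k < n, 1 ≤ K₀ k)
    (hε₁ : ∀ k < n, V₂ * M₂ / (γA - Jc) ^ 2 * Real.exp (-(θ / 2 * ((w - v : ℕ) : ℝ))) + Real.exp (-(θ * ((w - v : ℕ) : ℝ))) / (γA - Jc) ≤ ε₃₁ k)
    (hε₂ : ∀ k < n, M₂ * V₄ / (γA - Jc) * (γ * Real.exp (-(θ / 4 * ((w - v : ℕ) : ℝ))) + Real.exp (-(θ / 4 * R))) * bs k *
      (1 + Real.sqrt d * ((L : ℝ) - 1)) ≤ ε₃₁ k)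
    (hhalf : 1 / γA ≤ 1 / 2) (hsmallU : M₂ * V₄ / (γA - Jc) * (γ + Real.exp (-(θ / 4 * R))) ≤ 1 / 2)
    {δ : ℝ} (hδ : 0 < δ) (hδle : δ ≤ θ / Real.sqrt d) (hres : 0 < κ / 2 - δ / 2 * ((D : ℝ) ^ 2 * Real.sqrt d)) (t : ℕ)
    (hJn : Js n = ∅) {Etot : ℝ}
    (hledger : ∑ i ∈ Finset.range (n),
          (s1Const s D d κ * Ac * (γ * bs i) ^ D * Real.exp (-(κ / 4 * w)) * (Js i).card
            + s1Const s D d κ * Ac * bs i ^ D *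
              (Real.exp (-(κ / 4 * w)) * (corridorsBar L w v (((Js i).image fun x => x + τ i).image (boxIndex L))).card + Real.exp (-(κ / 4 * v)) * ((((Js i).image fun x => x + τ i).image (boxIndex L)).card * (L : ℝ) ^ d))
            + 2 * ((∑ y : ↥((Λ.image fun y => y - σ (i + 1)) \ ((Cs i).image (fun x => x + τ i) ∪ corridors L w (((Js i).image fun x => x + τ i).image (boxIndex L)))),
                Jc / (Real.cosh (θ * max (w : ℝ) (distToRegion ((((Js i).image fun x => x + τ i).image (boxIndex L)).biUnion (box L)) y)) - 1)) / (γA - Jc / (Real.cosh (θ * w) - 1)) +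
              ((1 + V * M / (γA - Jc)) ^ 2 * bs i ^ 2 *
              ∑ y : ↥((Λ.image fun y => y - σ (i + 1)) \ ((Cs i).image (fun x => x + τ i) ∪ corridors L w (((Js i).image fun x => x + τ i).image (boxIndex L)))),
                Jc / (Real.cosh (θ * max (w : ℝ) (distToRegion ((((Js i).image fun x => x + τ i).image (boxIndex L)).biUnion (box L)) y)) - 1) *
                  (1 + distToRegion ((Is i).image fun x => x + τ i) y) ^ 2) / 2)
          + (∑ m ∈ (((Js i).image fun x => x + τ i).image (boxIndex L)),
              (2 * (2 ^ ((t + 1).choose 2) * (4 * (s1Const s D d κ * Ac * bs i ^ D * (L : ℝ) ^ d)) ^ (t + 1) / (t + 1)!) +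
                    Real.exp (2 * (4 * (s1Const s D d κ * Ac * bs i ^ D * (L : ℝ) ^ d))) *
                      (3 * (((shrink L m w).card : ℝ) * Real.exp (-(bs i ^ 2 / 4)))) +
                    ∑ k ∈ Finset.range t,
                      (3 ^ (k + 1) * ((∑ π ∈ setPartitions (univ : Finset (Fin (k + 1))), ((π.card - 1)! : ℝ)) *
                          (s1Const s D d κ * Ac * bs i ^ D * Real.exp (-(κ / 4 * v)) * (L : ℝ) ^ d *
                            (4 * (s1Const s D d κ * Ac * bs i ^ D * (L : ℝ) ^ d)) ^ k)) +
                        3 ^ (k + 1) * (2 ^ (k + 1) * ((∑ π ∈ setPartitions (univ : Finset (Fin (k + 1))), ((π.card - 1)! : ℝ)) *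
                            ((min 1 (2 * ((shrink L m w).card : ℝ) * Real.exp (-(bs i ^ 2 / 4)))) ^ ((2 * (k + 1) : ℕ) : ℝ)⁻¹ *
                              ((1 + Ku i) ^ D * (Ac * (L : ℝ) ^ d * ∑ p ∈ Finset.Icc 1 s, ((admissible p D).card : ℝ) *
              ((2 / (1 - Real.exp (-(κ / 2 / (p : ℕ) / Real.sqrt d))) * Real.exp (κ / 2 / (p : ℕ) / Real.sqrt d)) ^ d) ^ (p - 1)) * momentConst D (2 * (k + 1)) (K₀ i).toNNReal) ^ (k + 1))) +
                          2 ^ ((k + 1) * D) * 2 ^ 2 ^ ((k + 1) * D) * K₀ i ^ ((k + 1) * D) * Real.exp (-(δ / 2 * ((v : ℝ) + 1))) *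
                            (Ac * Real.exp (δ / 2 * ((D : ℝ) ^ 2 * d)) * (L : ℝ) ^ d * ∑ p ∈ Finset.Icc 1 s, ((admissible p D).card : ℝ) *
              ((2 / (1 - Real.exp (-((κ / 2 - δ / 2 * ((D : ℝ) ^ 2 * Real.sqrt d)) / (p : ℕ) / Real.sqrt d))) *
                Real.exp ((κ / 2 - δ / 2 * ((D : ℝ) ^ 2 * Real.sqrt d)) / (p : ℕ) / Real.sqrt d)) ^ d) ^ (p - 1)) ^ (k + 1)) +
                        3 ^ (k + 1) * (2 ^ (k + 1) * ((∑ π ∈ setPartitions (univ : Finset (Fin (k + 1))), ((π.card - 1)! : ℝ)) *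
                            ((min 1 (2 * ((shrink L m w).card : ℝ) * Real.exp (-(bs i ^ 2 / 4)))) ^ ((2 * (k + 1) : ℕ) : ℝ)⁻¹ *
                              ((1 + Ku i) ^ D * (Ac * (L : ℝ) ^ d * ∑ p ∈ Finset.Icc 1 s, ((admissible p D).card : ℝ) *
              ((2 / (1 - Real.exp (-(κ / 2 / (p : ℕ) / Real.sqrt d))) * Real.exp (κ / 2 / (p : ℕ) / Real.sqrt d)) ^ d) ^ (p - 1)) * momentConst D (2 * (k + 1)) (K₀ i).toNNReal) ^ (k + 1))) +
                          (Ac * (L : ℝ) ^ d * ∑ p ∈ Finset.Icc 1 s, ((admissible p D).card : ℝ) *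
              ((2 / (1 - Real.exp (-(κ / 2 / (p : ℕ) / Real.sqrt d))) * Real.exp (κ / 2 / (p : ℕ) / Real.sqrt d)) ^ d) ^ (p - 1)) ^ (k + 1) * (2 ^ ((k + 1) * D) * 2 ^ 2 ^ ((k + 1) * D) *
                            ((((k + 1) * D : ℕ) : ℝ) * K₀ i ^ ((k + 1) * D) * ε₃₁ i)))) / (k + 1)!) +
            ∑ k ∈ Finset.range t,
          ((2 ^ (k + 1) * (2 ^ ((k + 1) * D) * 2 ^ 2 ^ ((k + 1) * D) * K₀ i ^ ((k + 1) * D)) *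
          ((Ac * Real.exp (δ / 2 * ((D : ℝ) ^ 2 * d)) *
              Real.exp (-((κ / 2 - δ / 2 * ((D : ℝ) ^ 2 * Real.sqrt d)) / 2 * w))) * ((Js i).image fun x => x + τ i).card *
            ∑ p ∈ Finset.Icc 1 s, ((admissible p D).card : ℝ) *
              ((2 / (1 - Real.exp (-((κ / 2 - δ / 2 * ((D : ℝ) ^ 2 * Real.sqrt d)) / 2 / (p : ℕ) / Real.sqrt d))) *
                Real.exp ((κ / 2 - δ / 2 * ((D : ℝ) ^ 2 * Real.sqrt d)) / 2 / (p : ℕ) / Real.sqrt d)) ^ d) ^ (p - 1)) *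
          (Ac * Real.exp (δ / 2 * ((D : ℝ) ^ 2 * d)) *
            ((1 : ℝ) * (2 / (1 - Real.exp (-(δ / (2 * ((k + 1 : ℕ) : ℝ)) / Real.sqrt d))) * Real.exp (δ / (2 * ((k + 1 : ℕ) : ℝ)) / Real.sqrt d)) ^ d) *
            ∑ p ∈ Finset.Icc 1 s, ((admissible p D).card : ℝ) *
              ((2 / (1 - Real.exp (-((κ / 2 - δ / 2 * ((D : ℝ) ^ 2 * Real.sqrt d)) / (p : ℕ) / Real.sqrt d))) *
                Real.exp ((κ / 2 - δ / 2 * ((D : ℝ) ^ 2 * Real.sqrt d)) / (p : ℕ) / Real.sqrt d)) ^ d) ^ (p - 1)) ^ k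
          + 2 ^ (k + 1) * (2 ^ ((k + 1) * D) * 2 ^ 2 ^ ((k + 1) * D) * K₀ i ^ ((k + 1) * D)) *
        ((((Js i).image fun x => x + τ i).image (boxIndex L)).card * (Ac * Real.exp (δ / 2 * ((D : ℝ) ^ 2 * d)) * Real.exp (-((κ / 2 - δ / 2 * ((D : ℝ) ^ 2 * Real.sqrt d)) / 2 * v)) *
          (L : ℝ) ^ d * ∑ p ∈ Finset.Icc 1 s, ((admissible p D).card : ℝ) *
              ((2 / (1 - Real.exp (-((κ / 2 - δ / 2 * ((D : ℝ) ^ 2 * Real.sqrt d)) / 2 / (p : ℕ) / Real.sqrt d))) *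
                Real.exp ((κ / 2 - δ / 2 * ((D : ℝ) ^ 2 * Real.sqrt d)) / 2 / (p : ℕ) / Real.sqrt d)) ^ d) ^ (p - 1))) *
        (Ac * Real.exp (δ / 2 * ((D : ℝ) ^ 2 * d)) *
          (2 / (1 - Real.exp (-(δ / (2 * ((k + 1 : ℕ) : ℝ)) / Real.sqrt d))) * Real.exp (δ / (2 * ((k + 1 : ℕ) : ℝ)) / Real.sqrt d)) ^ d *
          ∑ p ∈ Finset.Icc 1 s, ((admissible p D).card : ℝ) *
              ((2 / (1 - Real.exp (-((κ / 2 - δ / 2 * ((D : ℝ) ^ 2 * Real.sqrt d)) / (p : ℕ) / Real.sqrt d))) *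
                Real.exp ((κ / 2 - δ / 2 * ((D : ℝ) ^ 2 * Real.sqrt d)) / (p : ℕ) / Real.sqrt d)) ^ d) ^ (p - 1)) ^ k)
          + (2 ^ (k + 1) * (2 ^ ((k + 1) * D) * 2 ^ 2 ^ ((k + 1) * D) * K₀ i ^ ((k + 1) * D)) *
          (Ac * Real.exp (δ / 2 * ((D : ℝ) ^ 2 * d)) * Real.exp (-((κ / 2 - δ / 2 * ((D : ℝ) ^ 2 * Real.sqrt d)) / 2 * w)) *
            (corridorsBar L w v (((Js i).image fun x => x + τ i).image (boxIndex L))).card * ∑ p ∈ Finset.Icc 1 s, ((admissible p D).card : ℝ) *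
              ((2 / (1 - Real.exp (-((κ / 2 - δ / 2 * ((D : ℝ) ^ 2 * Real.sqrt d)) / 2 / (p : ℕ) / Real.sqrt d))) *
                Real.exp ((κ / 2 - δ / 2 * ((D : ℝ) ^ 2 * Real.sqrt d)) / 2 / (p : ℕ) / Real.sqrt d)) ^ d) ^ (p - 1)) *
          (Ac * Real.exp (δ / 2 * ((D : ℝ) ^ 2 * d)) *
            (2 / (1 - Real.exp (-(δ / (2 * ((k + 1 : ℕ) : ℝ)) / Real.sqrt d))) * Real.exp (δ / (2 * ((k + 1 : ℕ) : ℝ)) / Real.sqrt d)) ^ d *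
            ∑ p ∈ Finset.Icc 1 s, ((admissible p D).card : ℝ) *
              ((2 / (1 - Real.exp (-((κ / 2 - δ / 2 * ((D : ℝ) ^ 2 * Real.sqrt d)) / (p : ℕ) / Real.sqrt d))) *
                Real.exp ((κ / 2 - δ / 2 * ((D : ℝ) ^ 2 * Real.sqrt d)) / (p : ℕ) / Real.sqrt d)) ^ d) ^ (p - 1)) ^ k
          + 2 ^ (k + 1) * (2 ^ ((k + 1) * D) * 2 ^ 2 ^ ((k + 1) * D) * K₀ i ^ ((k + 1) * D)) *
        ((((Js i).image fun x => x + τ i).image (boxIndex L)).card * (Ac * Real.exp (δ / 2 * ((D : ℝ) ^ 2 * d)) * Real.exp (-((κ / 2 - δ / 2 * ((D : ℝ) ^ 2 * Real.sqrt d)) / 2 * v)) *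
          (L : ℝ) ^ d * ∑ p ∈ Finset.Icc 1 s, ((admissible p D).card : ℝ) *
              ((2 / (1 - Real.exp (-((κ / 2 - δ / 2 * ((D : ℝ) ^ 2 * Real.sqrt d)) / 2 / (p : ℕ) / Real.sqrt d))) *
                Real.exp ((κ / 2 - δ / 2 * ((D : ℝ) ^ 2 * Real.sqrt d)) / 2 / (p : ℕ) / Real.sqrt d)) ^ d) ^ (p - 1))) *
        (Ac * Real.exp (δ / 2 * ((D : ℝ) ^ 2 * d)) *
          (2 / (1 - Real.exp (-(δ / (2 * ((k + 1 : ℕ) : ℝ)) / Real.sqrt d))) * Real.exp (δ / (2 * ((k + 1 : ℕ) : ℝ)) / Real.sqrt d)) ^ d *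
          ∑ p ∈ Finset.Icc 1 s, ((admissible p D).card : ℝ) *
              ((2 / (1 - Real.exp (-((κ / 2 - δ / 2 * ((D : ℝ) ^ 2 * Real.sqrt d)) / (p : ℕ) / Real.sqrt d))) *
                Real.exp ((κ / 2 - δ / 2 * ((D : ℝ) ^ 2 * Real.sqrt d)) / (p : ℕ) / Real.sqrt d)) ^ d) ^ (p - 1)) ^ k)
          + 2 ^ ((k + 1) * D) * 2 ^ 2 ^ ((k + 1) * D) * K₀ i ^ ((k + 1) * D) *
        ((((Js i).image fun x => x + τ i).image (boxIndex L)).card * (((k + 1 : ℕ) : ℝ) * (k : ℝ) *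
          ((Ac * Real.exp (δ / 2 * ((D : ℝ) ^ 2 * d)) * ((L : ℝ) ^ d * (2 / (1 - Real.exp (-(δ / (2 * ((k + 1 : ℕ) : ℝ)) / Real.sqrt d))) * Real.exp (δ / (2 * ((k + 1 : ℕ) : ℝ)) / Real.sqrt d)) ^ d) *
              ∑ p ∈ Finset.Icc 1 s, ((admissible p D).card : ℝ) *
              ((2 / (1 - Real.exp (-((κ / 2 - δ / 2 * ((D : ℝ) ^ 2 * Real.sqrt d)) / (p : ℕ) / Real.sqrt d))) *
                Real.exp ((κ / 2 - δ / 2 * ((D : ℝ) ^ 2 * Real.sqrt d)) / (p : ℕ) / Real.sqrt d)) ^ d) ^ (p - 1)) * ((Ac * Real.exp (δ / 2 * ((D : ℝ) ^ 2 * d)) * Real.exp (-(δ / (2 * ((k + 1 : ℕ) : ℝ)) / 2 * ((w : ℝ) + v + 1))) * ((L : ℝ) ^ d * (2 / (1 - Real.exp (-(δ / (2 * ((k + 1 : ℕ) : ℝ)) / 2 / Real.sqrt d))) * Real.exp (δ / (2 * ((k + 1 : ℕ) : ℝ)) / 2 / Real.sqrt d)) ^ d) *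
              ∑ p ∈ Finset.Icc 1 s, ((admissible p D).card : ℝ) *
              ((2 / (1 - Real.exp (-((κ / 2 - δ / 2 * ((D : ℝ) ^ 2 * Real.sqrt d)) / (p : ℕ) / Real.sqrt d))) *
                Real.exp ((κ / 2 - δ / 2 * ((D : ℝ) ^ 2 * Real.sqrt d)) / (p : ℕ) / Real.sqrt d)) ^ d) ^ (p - 1)) *
             (Ac * Real.exp (δ / 2 * ((D : ℝ) ^ 2 * d)) * ((L : ℝ) ^ d * (2 / (1 - Real.exp (-(δ / (2 * ((k + 1 : ℕ) : ℝ)) / Real.sqrt d))) * Real.exp (δ / (2 * ((k + 1 : ℕ) : ℝ)) / Real.sqrt d)) ^ d) *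
              ∑ p ∈ Finset.Icc 1 s, ((admissible p D).card : ℝ) *
              ((2 / (1 - Real.exp (-((κ / 2 - δ / 2 * ((D : ℝ) ^ 2 * Real.sqrt d)) / (p : ℕ) / Real.sqrt d))) *
                Real.exp ((κ / 2 - δ / 2 * ((D : ℝ) ^ 2 * Real.sqrt d)) / (p : ℕ) / Real.sqrt d)) ^ d) ^ (p - 1)) ^ (k - 1)))))
          + (((Js i).image fun x => x + τ i).image (boxIndex L)).card * ((3 : ℝ) ^ (k + 1) *
        (2 ^ ((k + 1) * D) * 2 ^ 2 ^ ((k + 1) * D) * K₀ i ^ ((k + 1) * D) *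
            Real.exp (-(δ / 2 * ((v : ℝ) + 1))) *
          (Ac * Real.exp (δ / 2 * ((D : ℝ) ^ 2 * d)) * (L : ℝ) ^ d * ∑ p ∈ Finset.Icc 1 s, ((admissible p D).card : ℝ) *
              ((2 / (1 - Real.exp (-((κ / 2 - δ / 2 * ((D : ℝ) ^ 2 * Real.sqrt d)) / (p : ℕ) / Real.sqrt d))) *
                Real.exp ((κ / 2 - δ / 2 * ((D : ℝ) ^ 2 * Real.sqrt d)) / (p : ℕ) / Real.sqrt d)) ^ d) ^ (p - 1)) ^ (k + 1)))) / (k + 1)!)) ≤ Etot) :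
    ∫ z, cutoffBoltzmann (hamiltonian s D κ (as 0) (Js 0)) (Is 0) (γ * bs 0) z
          ∂((gaussianFieldOfKernel (condCov K (Cs 0))).map
          fun (ζ' : B1Eq324BenfattoLemma.Site d → ℝ) (x : B1Eq324BenfattoLemma.Site d) => condMean K (Cs 0) (zs 0) x + ζ' x) ≤
      Real.exp (cumulantSum (gaussianFieldOfKernel K) (hamiltonian s D κ (as 0) (Js 0)) t + Etot) := by
  classical
  have hL : 0 < L := by omega
  have hA' : A.PosDef := posDef_of_coercive hAs hγA0 hγA
  have hKpsd : IsPosSemidefKernel K := isPosSemidefKernel_kernel hK hA'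
  -- invariants along the chain
  have hinv := chain_invariants (L := L) (w := w) (v := v) (n := n)
    (Bs := fun k => ((Js k).image fun x => x + τ k).image (boxIndex L)) hsupp hA hJI hrecJ hrecI hreca
  -- (2) one class upper step at every frame-`k` datum and conditioning set, from the class rows
  choose! u hP using fun k (hk : k < n) =>
    exists_upper_step_of_classRows_frame hK (s := s) (D := D) (κ := κ) (a := as k) (J := Js k) (I := Is k) (L := L) (w := w) (v := v)
      (γ := γ) (b := bs k) (Ac := Ac) hΛ hAs hγA0 hγA hθ hJc hJcγ hV₂ hM₂ hV₄ hκ (hinv k hk.le).1 (hinv k hk.le).2.2.1 hAc0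
      (hinv k hk.le).2.1 hL2 hv (hb k hk) hγ0 hγ1 (hsmall k hk) (σ (k + 1)) (τ k) (hΓΛ k hk) (hBΛ k hk) (hKbs k hk) (hCΛ k hk) (hCsh k hk)
      (hCfar k hk) (hKuI k hk) (hKuK k hk) (hK₀ k hk) (hK₀1 k hk) (hε₁ k hk) (hε₂ k hk) hhalf hsmallU hδ hδle hres t
  -- (1) the class upper chain under `P̄^K` down to the stopping index (terminal conditioned volume `≤ 1`), fed with the chosen exponents; its
  -- part kernels (parts `shrink − (C_k+τ_k)`) served from the standard ones by the parts adapter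
  have hchain' := upperPavementChainCond_le_exp_of_eq_empty hK hAs hγA0 hγA hθ hJc hJcγ hV hM hguard hκ hL hw hv hγ1 hAc0 hsupp hA hJI hrecJ hrecI
    hreca hrecC hrecz hrecb hb hγb hσ0 hrecσ (Bs := fun k => ((Js k).image fun x => x + τ k).image (boxIndex L)) (fun k _ => subset_rfl) hCΛ hΓΛ hBΛ
    (Kbs := Kbs) (fun k hk => partKernel_row_sdiff_of_disjoint (hBΛ k hk) (hKbs k hk) (hCsh k hk)) u (fun k hk => (hP k hk).1) hC0 hJn (s := s) (D := D)
  -- (3) collecting the errors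
  exact le_exp_cumulantSum_add_of_chain hKpsd (as 0) (fun R _ z => rfl) hsupp hrecJ hreca hσ0 hrecσ hJn u _ _ hchain'
    (fun k hk => (hP k hk).2) hledger

end Assembly

end Literature.MathematicalPhysics.QuantumFieldTheory.Balaban1983to89.B1Eq324BenfattoKernelSect5UpperAssembly

end
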